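/-
Copyright: internal research formalization. Source texts: G. Kempf, F. Knudsen, D. Mumford,
B. Saint-Donat, Toroidal Embeddings I (LNM 339, Springer 1973) [KempfEtAl1973], Ch. II §1
(conical polyhedral complexes with integral structure: charts and their compatibility on
overlaps, Def. 5 p. 69–70) and §2 (Theorems 4*, 9*, 11*: the subdivision theorems of Ch. I §2
"carry over" to complexes); W. Fulton, Introduction to Toric Varieties [Fulton1993Toric], §1.4
p. 20–21 (fans; isomorphic fans under lattice isomorphisms), §2.6 pp. 47–48.
-/
import Mathlib
import HarnessLib
import Literature.Geometry.PolyhedralFans.RelativeProjectiveRefinement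

/-!
# Transport of cones, fans, star subdivisions and lattice data along a linear map injective on a
# subspace ("links" between charts of a conical complex)

Topic: `Literature/Geometry/PolyhedralFans`. In [KempfEtAl1973] Ch. II §1 a conical polyhedral
complex with integral structure is given by CHARTS — embeddings of its cells as rational
polyhedral cones `τ ⊆ ℚ^κ` — and two charts of the same cell differ by a map `E` which is linear
and injective on the span of `τ`, carries `τ` onto `τ′` and the lattice points of `span τ` onto
those of `span τ′` (Def. 5, compatibility on overlaps); Ch. II §2 then states that the
subdivision theorems of Ch. I §2 (Thms. 4*, 9*, 11*) hold for complexes because every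
construction of Ch. I is COMPATIBLE WITH SUCH MAPS. This file proves that compatibility for the
constructions of this library (block A1 "transport" of the LINKED-KKMS programme of the summit
`ResolutionOfSingularities`, W8.1 / Kato (10.4) in atlas form): for a linear map `E : V → W`
injective on a subspace `U` (hypothesis `∀ x ∈ U, E x = 0 → x = 0`) and cones contained in `U`,

* `PointedCone.map E` preserves and reflects: membership, inclusion, intersections, faces
  (`isFaceOf_map_iff_of_subset`, `exists_isFaceOf_map_eq_of_isFaceOf_map`), salience, finite
  generation, rays and joins with rays (`map_ray`, `map_sup_ray`), hulls of finite sets,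
  linear independence of generators and simpliciality (`isSimplicial_map_of_subset`);
* `Fan.mapOn` — the image fan `{σ.map E : σ ∈ Δ}` of a fan whose cones lie in `U`
  ([Fulton1993Toric] §1.4 p. 21: fans corresponding under a lattice isomorphism); its support is
  `E '' |Δ|`; **star subdivision commutes with transport** (`Fan.mapOn_starSubdivision_cones`:
  the image of `Δ.starSubdivision v` is the star subdivision of the image through `E v`, for
  `v ∈ U`), and so does `starIter`; restriction to a cone commutes with transport; the
  `v`-coordinate is invariant (`Fan.starCoord_mapOn : starCoord_{E v} (E x) = starCoord_v x`);
* over `ℚ` with the lattices `ℤ^κ ⊆ ℚ^κ`, `ℤ^{κ'} ⊆ ℚ^{κ'}` and the two printed lattice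
  conditions (`E` maps lattice points of `U` to lattice points, and every lattice point of `E U`
  comes from a lattice point of `U`): primitive vectors, regular generating sets
  (`IsRegularGens`), primitive simplicial generating sets (`IsPrimGens`), rationality,
  (primitive) simpliciality and regularity of fans are transported, and the sum of the primitive
  generators (the barycentre used by the barycentric subdivision) is mapped to the sum of the
  primitive generators of the image.

All statements are PROVED; no named facts, no new notions beyond the image fan `Fan.mapOn`.

## Not here

The links of a concrete atlas (they come from the scheme side, Kato 1994 / Nizioł 2006), flag
cones and the barycentric subdivision (block A2), the synchronised subdivision loop (A4/A5).
-/

noncomputable section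

namespace Literature.Geometry.PolyhedralFans

open PointedCone Finset

/-! ## Cones under a linear map: general facts -/

section General

variable {𝕜 : Type*} [Field 𝕜] [LinearOrder 𝕜] [IsStrictOrderedRing 𝕜]
variable {V W : Type*} [AddCommGroup V] [Module 𝕜 V] [AddCommGroup W] [Module 𝕜 W]
variable (E : V →ₗ[𝕜] W)

/-- The image of the hull of a set is the hull of the image ([Fulton1993Toric] §1.2 p. 9: a cone
is the set of nonnegative combinations of its generators, and `E` is linear).
[cite: Fulton1993Toric, §1.2 p. 9] -/
theorem map_hull (s : Set V) : (PointedCone.hull 𝕜 s).map E = PointedCone.hull 𝕜 (E '' s) := by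
  change Submodule.map _ (Submodule.span _ s) = Submodule.span _ _
  rw [Submodule.map_span]
  rfl

/-- The image of the hull of a finite set is the hull of the image finite set.
[cite: Fulton1993Toric, §1.2 p. 9] -/
theorem map_hull_finset [DecidableEq W] (S : Finset V) :
    (PointedCone.hull 𝕜 (S : Set V)).map E = PointedCone.hull 𝕜 ((S.image E : Finset W) : Set W) := by
  rw [map_hull, Finset.coe_image]

/-- The image of a ray is the ray through the image vector. [cite: Fulton1993Toric, §2.6 p. 47] -/
theorem map_ray (v : V) : (ray 𝕜 v).map E = ray 𝕜 (E v) := by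
  rw [ray, map_hull, Set.image_singleton]

/-- Images commute with joins. [cite: Fulton1993Toric, §1.2 p. 9] -/
theorem map_sup (ρ ρ' : PointedCone 𝕜 V) : (ρ ⊔ ρ').map E = ρ.map E ⊔ ρ'.map E :=
  Submodule.map_sup _ _ _

/-- The image of the join of a cone with a ray is the join of the images.
[cite: Fulton1993Toric, §2.6 p. 47] -/
theorem map_sup_ray (ρ : PointedCone 𝕜 V) (v : V) :
    (ρ ⊔ ray 𝕜 v).map E = ρ.map E ⊔ ray 𝕜 (E v) := by
  rw [map_sup, map_ray]

/-- Images are monotone. [cite: Fulton1993Toric, §1.2 p. 9] -/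
theorem map_mono' {ρ ρ' : PointedCone 𝕜 V} (h : ρ ≤ ρ') : ρ.map E ≤ ρ'.map E :=
  Submodule.map_mono h

/-- The image of a finitely generated cone is finitely generated. [cite: Fulton1993Toric, §1.2 p. 9] -/
theorem fg_map {ρ : PointedCone 𝕜 V} (h : ρ.FG) : (ρ.map E).FG :=
  Submodule.FG.map _ h

/-- The image of the zero cone is the zero cone. [cite: Fulton1993Toric, §1.2 p. 9] -/
theorem map_bot : (⊥ : PointedCone 𝕜 V).map E = ⊥ :=
  Submodule.map_bot _

/-- **Faces pull back along images**: a face `G` of the image `ρ.map E` is the image of the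
sub-cone `E⁻¹(G) ∩ ρ` of `ρ`, which is a face of `ρ` (no injectivity needed).
[cite: Fulton1993Toric, §1.2 p. 10] -/
theorem exists_isFaceOf_map_eq_of_isFaceOf_map {ρ : PointedCone 𝕜 V} {G : PointedCone 𝕜 W}
    (hG : G.IsFaceOf (ρ.map E)) : ∃ F : PointedCone 𝕜 V, F.IsFaceOf ρ ∧ F.map E = G := by
  refine ⟨G.comap E ⊓ ρ, ⟨inf_le_right, fun {x} {y} {a} hx hy ha hxy => ?_⟩, ?_⟩
  · refine Submodule.mem_inf.mpr ⟨?_, hx⟩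
    rw [PointedCone.mem_comap]
    have h1 : E (a • x + y) ∈ G := (Submodule.mem_inf.mp hxy).1
    rw [map_add, map_smul] at h1
    exact hG.mem_of_smul_add_mem (PointedCone.mem_map.mpr ⟨x, hx, rfl⟩)
      (PointedCone.mem_map.mpr ⟨y, hy, rfl⟩) ha h1
  · apply le_antisymm
    · rintro _ ⟨x, hx, rfl⟩
      exact (Submodule.mem_inf.mp hx).1
    · intro y hy
      obtain ⟨x, hx, rfl⟩ := PointedCone.mem_map.mp (hG.le hy)
      exact ⟨x, Submodule.mem_inf.mpr ⟨hy, hx⟩, rfl⟩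

end General

/-! ## Cones inside a subspace on which the map is injective -/

section InjOn

variable {𝕜 : Type*} [Field 𝕜] [LinearOrder 𝕜] [IsStrictOrderedRing 𝕜]
variable {V W : Type*} [AddCommGroup V] [Module 𝕜 V] [AddCommGroup W] [Module 𝕜 W]
variable {E : V →ₗ[𝕜] W} {U : Submodule 𝕜 V}

omit [LinearOrder 𝕜] [IsStrictOrderedRing 𝕜] in
/-- Injectivity on the subspace `U`, from the kernel condition (the links of a conical complex are
injective on the span of the cell, [KempfEtAl1973] II §1 Def. 5). [cite: KempfEtAl1973, II §1 Def. 5] -/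
theorem eq_of_map_eq_of_mem (hinj : ∀ x ∈ U, E x = 0 → x = 0) {x y : V} (hx : x ∈ U) (hy : y ∈ U)
    (h : E x = E y) : x = y := by
  have h0 : E (x - y) = 0 := by rw [map_sub, h, sub_self]
  exact sub_eq_zero.mp (hinj _ (U.sub_mem hx hy) h0)

omit [LinearOrder 𝕜] [IsStrictOrderedRing 𝕜] in
/-- `E` is injective on `U` as a set map. [cite: KempfEtAl1973, II §1 Def. 5] -/
theorem injOn_of_ker (hinj : ∀ x ∈ U, E x = 0 → x = 0) : Set.InjOn E (U : Set V) :=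
  fun _ hx _ hy h => eq_of_map_eq_of_mem hinj hx hy h

/-- For a cone `ρ ⊆ U` and `x ∈ U`: `E x ∈ ρ.map E ↔ x ∈ ρ`. [cite: Fulton1993Toric, §1.4 p. 21] -/
theorem map_mem_map_iff_of_subset (hinj : ∀ x ∈ U, E x = 0 → x = 0) {ρ : PointedCone 𝕜 V}
    (hρ : (ρ : Set V) ⊆ U) {x : V} (hx : x ∈ U) : E x ∈ ρ.map E ↔ x ∈ ρ := by
  constructor
  · rintro ⟨x', hx', hEx⟩
    rwa [← eq_of_map_eq_of_mem hinj (hρ hx') hx hEx]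
  · exact fun h => ⟨x, h, rfl⟩

/-- For cones `ρ, ρ' ⊆ U`: `ρ.map E ≤ ρ'.map E ↔ ρ ≤ ρ'`. [cite: Fulton1993Toric, §1.4 p. 21] -/
theorem map_le_map_iff_of_subset (hinj : ∀ x ∈ U, E x = 0 → x = 0) {ρ ρ' : PointedCone 𝕜 V}
    (hρ : (ρ : Set V) ⊆ U) (hρ' : (ρ' : Set V) ⊆ U) : ρ.map E ≤ ρ'.map E ↔ ρ ≤ ρ' := by
  refine ⟨fun h x hx => ?_, map_mono' E⟩
  exact (map_mem_map_iff_of_subset hinj hρ' (hρ hx)).mp (h ⟨x, hx, rfl⟩)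

/-- For cones `ρ, ρ' ⊆ U`: `ρ.map E = ρ'.map E ↔ ρ = ρ'`. [cite: Fulton1993Toric, §1.4 p. 21] -/
theorem map_eq_map_iff_of_subset (hinj : ∀ x ∈ U, E x = 0 → x = 0) {ρ ρ' : PointedCone 𝕜 V}
    (hρ : (ρ : Set V) ⊆ U) (hρ' : (ρ' : Set V) ⊆ U) : ρ.map E = ρ'.map E ↔ ρ = ρ' := by
  constructor
  · intro h
    exact le_antisymm ((map_le_map_iff_of_subset hinj hρ hρ').mp h.le)
      ((map_le_map_iff_of_subset hinj hρ' hρ).mp h.ge)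
  · rintro rfl; rfl

/-- Images commute with intersections for cones inside `U`. [cite: Fulton1993Toric, §1.4 p. 21] -/
theorem map_inf_of_subset (hinj : ∀ x ∈ U, E x = 0 → x = 0) {ρ ρ' : PointedCone 𝕜 V}
    (hρ : (ρ : Set V) ⊆ U) (hρ' : (ρ' : Set V) ⊆ U) :
    (ρ ⊓ ρ').map E = ρ.map E ⊓ ρ'.map E := by
  apply le_antisymm
  · exact le_inf (map_mono' E inf_le_left) (map_mono' E inf_le_right)
  · rintro y ⟨⟨x, hx, rfl⟩, hx'⟩
    exact ⟨x, Submodule.mem_inf.mpr ⟨hx, (map_mem_map_iff_of_subset hinj hρ' (hρ hx)).mp hx'⟩,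
      rfl⟩

/-- A salient cone inside `U` has salient image. [cite: Fulton1993Toric, §1.2 p. 14] -/
theorem isSalient_map_of_subset (hinj : ∀ x ∈ U, E x = 0 → x = 0) {ρ : PointedCone 𝕜 V}
    (hρ : (ρ : Set V) ⊆ U) (h : IsSalient ρ) : IsSalient (ρ.map E) := by
  intro y hy hny
  obtain ⟨x, hx, rfl⟩ := PointedCone.mem_map.mp hy
  obtain ⟨x', hx', hneg⟩ := PointedCone.mem_map.mp hny
  have hsum : E (x' + x) = 0 := by rw [map_add, hneg, neg_add_cancel]
  have hx'x : x' + x = 0 := hinj _ (U.add_mem (hρ hx') (hρ hx)) hsum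
  have hnegx : -x ∈ ρ := by
    have : x' = -x := eq_neg_of_add_eq_zero_left hx'x
    rwa [this] at hx'
  rw [h hx hnegx, map_zero]

/-- **Faces are transported**: for a face `F` of a cone `ρ ⊆ U`, the image `F.map E` is a face of
`ρ.map E` ([KempfEtAl1973] II §1: the charts of a cell induce charts of its faces).
[cite: KempfEtAl1973, II §1 Def. 5] -/
theorem isFaceOf_map_of_isFaceOf (hinj : ∀ x ∈ U, E x = 0 → x = 0) {F ρ : PointedCone 𝕜 V}
    (hF : F.IsFaceOf ρ) (hρ : (ρ : Set V) ⊆ U) : (F.map E).IsFaceOf (ρ.map E) := by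
  refine ⟨map_mono' E hF.le, fun {y} {y'} {a} hy hy' ha hmem => ?_⟩
  obtain ⟨x, hx, rfl⟩ := PointedCone.mem_map.mp hy
  obtain ⟨x', hx', rfl⟩ := PointedCone.mem_map.mp hy'
  obtain ⟨z, hz, hEz⟩ := PointedCone.mem_map.mp hmem
  have hEeq : E z = E (a • x + x') := by rw [hEz, map_add, map_smul]
  have hzeq : z = a • x + x' :=
    eq_of_map_eq_of_mem hinj (hρ (hF.le hz)) (U.add_mem (U.smul_mem a (hρ hx)) (hρ hx')) hEeq
  exact ⟨x, hF.mem_of_smul_add_mem hx hx' ha (hzeq ▸ hz), rfl⟩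

/-- **Faces correspond**: for cones `F, ρ ⊆ U`, `F.map E` is a face of `ρ.map E` iff `F` is a face
of `ρ`. [cite: KempfEtAl1973, II §1 Def. 5] -/
theorem isFaceOf_map_iff_of_subset (hinj : ∀ x ∈ U, E x = 0 → x = 0) {F ρ : PointedCone 𝕜 V}
    (hF : (F : Set V) ⊆ U) (hρ : (ρ : Set V) ⊆ U) :
    (F.map E).IsFaceOf (ρ.map E) ↔ F.IsFaceOf ρ := by
  refine ⟨fun h => ?_, fun h => isFaceOf_map_of_isFaceOf hinj h hρ⟩
  obtain ⟨F', hF'ρ, hF'E⟩ := exists_isFaceOf_map_eq_of_isFaceOf_map E h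
  have hF'U : (F' : Set V) ⊆ U := fun x hx => hρ (hF'ρ.le hx)
  rwa [← (map_eq_map_iff_of_subset hinj hF'U hF).mp hF'E]

/-- The faces of the image of a cone `ρ ⊆ U` are exactly the images of the faces of `ρ`.
[cite: KempfEtAl1973, II §1 Def. 5] -/
theorem isFaceOf_map_iff_exists (hinj : ∀ x ∈ U, E x = 0 → x = 0) {ρ : PointedCone 𝕜 V}
    (hρ : (ρ : Set V) ⊆ U) {G : PointedCone 𝕜 W} :
    G.IsFaceOf (ρ.map E) ↔ ∃ F : PointedCone 𝕜 V, F.IsFaceOf ρ ∧ F.map E = G := by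
  refine ⟨exists_isFaceOf_map_eq_of_isFaceOf_map E, ?_⟩
  rintro ⟨F, hF, rfl⟩
  exact isFaceOf_map_of_isFaceOf hinj hF hρ

omit [LinearOrder 𝕜] [IsStrictOrderedRing 𝕜] in
/-- **Linear independence of generators is transported** for a family inside `U`.
[cite: Fulton1993Toric, §2.1 p. 29] -/
theorem linearIndepOn_image_of_subset (hinj : ∀ x ∈ U, E x = 0 → x = 0) {s : Set V}
    (hs : s ⊆ U) (hli : LinearIndepOn 𝕜 id s) : LinearIndepOn 𝕜 id (E '' s) := by
  have hinj' : Set.InjOn E (Submodule.span 𝕜 (id '' s) : Set V) := by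
    rw [Set.image_id]
    exact (injOn_of_ker hinj).mono (Submodule.span_le.mpr hs)
  have h := hli.map_injOn E hinj'
  exact h.id_image

/-- **Simplicial cones are transported**: a simplicial cone inside `U` has simplicial image.
[cite: Fulton1993Toric, §2.1 p. 29] -/
theorem isSimplicial_map_of_subset (hinj : ∀ x ∈ U, E x = 0 → x = 0) {ρ : PointedCone 𝕜 V}
    (hρ : (ρ : Set V) ⊆ U) (h : ρ.IsSimplicial) : (ρ.map E).IsSimplicial := by
  obtain ⟨s, hsfin, hli, hs⟩ := h
  have hsU : s ⊆ U := fun x hx => hρ (hs ▸ PointedCone.subset_hull hx)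
  refine ⟨E '' s, hsfin.image _, linearIndepOn_image_of_subset hinj hsU hli, ?_⟩
  rw [← hs, map_hull]

/-- The span of the image of a cone is the image of its span ([Fulton1993Toric] §1.2 p. 9: the
linear span `ℝ·σ = σ + (−σ)` of a cone). [cite: Fulton1993Toric, §1.2 p. 9] -/
theorem span_coe_map (E : V →ₗ[𝕜] W) (ρ : PointedCone 𝕜 V) :
    Submodule.span 𝕜 (ρ.map E : Set W) = (Submodule.span 𝕜 (ρ : Set V)).map E := by
  rw [PointedCone.coe_map, Submodule.map_span]

/-- **Dimension is transported**: for a cone `ρ ⊆ U` the span of the image has the same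
dimension as the span of `ρ` ([KempfEtAl1973] II §1: the dimension of a cell is read in any
chart). [cite: KempfEtAl1973, II §1 Def. 5] -/
theorem finrank_span_map_of_subset [FiniteDimensional 𝕜 V] (hinj : ∀ x ∈ U, E x = 0 → x = 0)
    {ρ : PointedCone 𝕜 V} (hρ : (ρ : Set V) ⊆ U) :
    Module.finrank 𝕜 (Submodule.span 𝕜 (ρ.map E : Set W)) =
      Module.finrank 𝕜 (Submodule.span 𝕜 (ρ : Set V)) := by
  rw [span_coe_map]
  set P := Submodule.span 𝕜 (ρ : Set V) with hP
  have hPU : P ≤ U := Submodule.span_le.mpr hρ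
  have hker : LinearMap.ker (E.domRestrict P) = ⊥ := by
    rw [Submodule.eq_bot_iff]
    intro x hx
    rw [LinearMap.mem_ker, LinearMap.domRestrict_apply] at hx
    exact Subtype.ext (hinj _ (hPU x.2) hx)
  have hrange : LinearMap.range (E.domRestrict P) = P.map E := LinearMap.range_domRestrict _ _
  rw [← hrange]
  exact (LinearMap.finrank_range_of_inj (LinearMap.ker_eq_bot.mp hker))

omit [LinearOrder 𝕜] [IsStrictOrderedRing 𝕜] in
/-- **Sums of generators are transported**: for a finite set `S ⊆ U`, `E (Σ_{s ∈ S} s)` is the sum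
of the elements of the image set `E '' S` (injectivity on `U` makes `E` a bijection `S → E '' S`;
this is the transport of the barycentre `Σ` (primitive generators) used by the barycentric
subdivision). [cite: KempfEtAl1973, II §2 Thm. 4*] -/
theorem map_sum_eq_sum_image [DecidableEq W] (hinj : ∀ x ∈ U, E x = 0 → x = 0) {S : Finset V}
    (hS : (S : Set V) ⊆ U) : E (∑ s ∈ S, s) = ∑ s' ∈ S.image E, s' := by
  rw [map_sum, Finset.sum_image]
  exact fun x hx y hy h => eq_of_map_eq_of_mem hinj (hS hx) (hS hy) h

end InjOn

/-! ## Fans under a linear map injective on a subspace containing their cones -/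

section FanMap

variable {𝕜 : Type*} [Field 𝕜] [LinearOrder 𝕜] [IsStrictOrderedRing 𝕜]
variable {V W : Type*} [AddCommGroup V] [Module 𝕜 V] [AddCommGroup W] [Module 𝕜 W]

namespace Fan

/-- A fan is determined by its set of cones. [cite: Fulton1993Toric, §1.4 p. 20] -/
theorem eq_of_cones_eq {Δ Δ' : Fan 𝕜 V} (h : Δ.cones = Δ'.cones) : Δ = Δ' := by
  cases Δ; cases Δ'; cases h; rfl

/-- The cones of `Δ` all lie in the subspace `U`. [cite: KempfEtAl1973, II §1 Def. 5] -/
def ConesSubset (Δ : Fan 𝕜 V) (U : Submodule 𝕜 V) : Prop :=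
  ∀ ⦃σ : PointedCone 𝕜 V⦄, σ ∈ Δ.cones → (σ : Set V) ⊆ U

/-- `ConesSubset` in terms of the support. [cite: KempfEtAl1973, II §1 Def. 5] -/
theorem conesSubset_iff_support_subset {Δ : Fan 𝕜 V} {U : Submodule 𝕜 V} :
    Δ.ConesSubset U ↔ Δ.support ⊆ U := by
  constructor
  · intro h x hx
    obtain ⟨σ, hσ, hxσ⟩ := mem_support.mp hx
    exact h hσ hxσ
  · intro h σ hσ x hx
    exact h (mem_support.mpr ⟨σ, hσ, hx⟩)

/-- The cones of a star subdivision lie in `U` if the cones of `Δ` do. [cite: Fulton1993Toric, §2.6 p. 47] -/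
theorem ConesSubset.starSubdivision {Δ : Fan 𝕜 V} {U : Submodule 𝕜 V} (h : Δ.ConesSubset U)
    (v : V) : (Δ.starSubdivision v).ConesSubset U := by
  intro ρ hρ
  obtain ⟨σ, hσ, hle⟩ := starSubdivision_exists_le hρ
  exact fun x hx => h hσ (hle hx)

/-- The cones of an iterated star subdivision lie in `U` if the cones of `Δ` do.
[cite: Fulton1993Toric, §2.6 p. 48] -/
theorem ConesSubset.starIter {U : Submodule 𝕜 V} :
    ∀ (l : List V) {Δ : Fan 𝕜 V}, Δ.ConesSubset U → (Δ.starIter l).ConesSubset U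
  | [], _, h => h
  | v :: l, _, h => ConesSubset.starIter l (h.starSubdivision v)

/-- The cones of a restriction lie in `U` if the cones of `Δ` do, or if the restricting cone does.
[cite: Fulton1993Toric, §2.6 p. 45] -/
theorem ConesSubset.restrict {Δ : Fan 𝕜 V} {U : Submodule 𝕜 V} (h : Δ.ConesSubset U)
    (σ : PointedCone 𝕜 V) : (Δ.restrict σ).ConesSubset U :=
  fun _ hτ => h hτ.1

/-- The restriction of any fan to a cone `σ ⊆ U` has its cones in `U`. [cite: Fulton1993Toric, §2.6 p. 45] -/
theorem conesSubset_restrict_of_subset (Δ : Fan 𝕜 V) {U : Submodule 𝕜 V} {σ : PointedCone 𝕜 V}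
    (hσ : (σ : Set V) ⊆ U) : (Δ.restrict σ).ConesSubset U :=
  fun _ hτ _ hx => hσ (hτ.2 hx)

/-- **The image fan.** For a fan `Δ` whose cones lie in a subspace `U` on which the linear map `E`
is injective, the images `σ.map E` of its cones form a fan ([Fulton1993Toric] §1.4 p. 21: a lattice
isomorphism carries a fan to a fan; [KempfEtAl1973] II §1 Def. 5: change of chart).
[cite: KempfEtAl1973, II §1 Def. 5] -/
def mapOn (Δ : Fan 𝕜 V) (E : V →ₗ[𝕜] W) {U : Submodule 𝕜 V} (hΔ : Δ.ConesSubset U)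
    (hinj : ∀ x ∈ U, E x = 0 → x = 0) : Fan 𝕜 W where
  cones := (fun σ => σ.map E) '' Δ.cones
  finite := Δ.finite.image _
  fg := by
    rintro _ ⟨σ, hσ, rfl⟩
    exact fg_map E (Δ.fg hσ)
  salient := by
    rintro _ ⟨σ, hσ, rfl⟩
    exact isSalient_map_of_subset hinj (hΔ hσ) (Δ.salient hσ)
  face_mem := by
    rintro _ ⟨σ, hσ, rfl⟩ G hG
    obtain ⟨F, hF, rfl⟩ := exists_isFaceOf_map_eq_of_isFaceOf_map E hG
    exact ⟨F, Δ.face_mem hσ hF, rfl⟩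
  inf_isFaceOf := by
    rintro _ ⟨σ, hσ, rfl⟩ _ ⟨τ, hτ, rfl⟩
    rw [← map_inf_of_subset hinj (hΔ hσ) (hΔ hτ)]
    exact isFaceOf_map_of_isFaceOf hinj (Δ.inf_isFaceOf hσ hτ) (hΔ hσ)

variable {Δ : Fan 𝕜 V} {E : V →ₗ[𝕜] W} {U : Submodule 𝕜 V} {hΔ : Δ.ConesSubset U}
  {hinj : ∀ x ∈ U, E x = 0 → x = 0}

/-- The cones of the image fan. [cite: KempfEtAl1973, II §1 Def. 5] -/
@[simp] theorem mapOn_cones : (Δ.mapOn E hΔ hinj).cones = (fun σ => σ.map E) '' Δ.cones := rfl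

/-- Membership in the image fan. [cite: KempfEtAl1973, II §1 Def. 5] -/
theorem mem_mapOn_iff {ρ : PointedCone 𝕜 W} :
    ρ ∈ (Δ.mapOn E hΔ hinj).cones ↔ ∃ σ ∈ Δ.cones, σ.map E = ρ := Iff.rfl

/-- The image of a cone of `Δ` is a cone of the image fan. [cite: KempfEtAl1973, II §1 Def. 5] -/
theorem map_mem_mapOn {σ : PointedCone 𝕜 V} (hσ : σ ∈ Δ.cones) :
    σ.map E ∈ (Δ.mapOn E hΔ hinj).cones := ⟨σ, hσ, rfl⟩

/-- For a cone `σ ⊆ U`: `σ.map E` is a cone of the image fan iff `σ` is a cone of `Δ`.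
[cite: KempfEtAl1973, II §1 Def. 5] -/
theorem map_mem_mapOn_iff {σ : PointedCone 𝕜 V} (hσ : (σ : Set V) ⊆ U) :
    σ.map E ∈ (Δ.mapOn E hΔ hinj).cones ↔ σ ∈ Δ.cones := by
  refine ⟨?_, map_mem_mapOn⟩
  rintro ⟨σ', hσ', h⟩
  rwa [← (map_eq_map_iff_of_subset hinj (hΔ hσ') hσ).mp h]

/-- The image fan only depends on the cones (proof arguments are irrelevant).
[cite: KempfEtAl1973, II §1 Def. 5] -/
theorem mapOn_cones_congr {Δ' : Fan 𝕜 V} {hΔ' : Δ'.ConesSubset U}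
    {hinj' : ∀ x ∈ U, E x = 0 → x = 0} (h : Δ.cones = Δ'.cones) :
    (Δ.mapOn E hΔ hinj).cones = (Δ'.mapOn E hΔ' hinj').cones := by
  rw [mapOn_cones, mapOn_cones, h]

/-- **The support of the image fan is the image of the support.** [cite: KempfEtAl1973, II §1 Def. 5] -/
theorem mapOn_support : (Δ.mapOn E hΔ hinj).support = E '' Δ.support := by
  ext y
  rw [mem_support]
  constructor
  · rintro ⟨_, ⟨σ, hσ, rfl⟩, ⟨x, hx, rfl⟩⟩
    exact ⟨x, mem_support.mpr ⟨σ, hσ, hx⟩, rfl⟩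
  · rintro ⟨x, hx, rfl⟩
    obtain ⟨σ, hσ, hxσ⟩ := mem_support.mp hx
    exact ⟨σ.map E, map_mem_mapOn hσ, ⟨x, hxσ, rfl⟩⟩

/-- The cones of the image fan lie in the image subspace `E U`. [cite: KempfEtAl1973, II §1 Def. 5] -/
theorem conesSubset_mapOn : (Δ.mapOn E hΔ hinj).ConesSubset (U.map E) := by
  rintro _ ⟨σ, hσ, rfl⟩ _ ⟨x, hx, rfl⟩
  exact Submodule.mem_map_of_mem (hΔ hσ hx)

/-- **Star subdivision commutes with transport**: for `v ∈ U`, the image of the star subdivision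
of `Δ` through `v` is the star subdivision of the image fan through `E v` ([KempfEtAl1973] II §2:
"Theorem 4*", the subdivision constructions of Ch. I are compatible with the charts;
[Fulton1993Toric] §2.6 p. 47, the cone-by-cone recipe). [cite: KempfEtAl1973, II §2 Thm. 4*] -/
theorem mapOn_starSubdivision_cones {v : V} (hv : v ∈ U) :
    ((Δ.starSubdivision v).mapOn E (hΔ.starSubdivision v) hinj).cones =
      ((Δ.mapOn E hΔ hinj).starSubdivision (E v)).cones := by
  have hmemv : ∀ {σ : PointedCone 𝕜 V}, σ ∈ Δ.cones → (E v ∈ σ.map E ↔ v ∈ σ) :=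
    fun hσ => map_mem_map_iff_of_subset hinj (hΔ hσ) hv
  ext ρ
  rw [mapOn_cones, starSubdivision_cones, starSubdivision_cones, Set.mem_image]
  constructor
  · rintro ⟨ρ₀, hρ₀, rfl⟩
    rcases mem_starCones_iff.mp hρ₀ with ⟨hρ₀Δ, hvρ₀⟩ | ⟨τ, hτ, hvτ, ⟨σ, hσ, hτσ, hvσ⟩, rfl⟩
    · exact mem_starCones_of_not_mem (map_mem_mapOn hρ₀Δ) fun h => hvρ₀ ((hmemv hρ₀Δ).mp h)
    · rw [map_sup_ray]
      exact sup_ray_mem_starCones (map_mem_mapOn hτ) (fun h => hvτ ((hmemv hτ).mp h))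
        (map_mem_mapOn hσ) (map_mono' E hτσ) ((hmemv hσ).mpr hvσ)
  · intro hρ
    rcases mem_starCones_iff.mp hρ with ⟨⟨ρ₀, hρ₀, rfl⟩, hvρ⟩ |
        ⟨_, ⟨τ, hτ, rfl⟩, hvτ, ⟨_, ⟨σ, hσ, rfl⟩, hτσ, hvσ⟩, rfl⟩
    · exact ⟨ρ₀, mem_starCones_of_not_mem hρ₀ fun h => hvρ ((hmemv hρ₀).mpr h), rfl⟩
    · refine ⟨τ ⊔ ray 𝕜 v, sup_ray_mem_starCones hτ (fun h => hvτ ((hmemv hτ).mpr h)) hσ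
        ((map_le_map_iff_of_subset hinj (hΔ hτ) (hΔ hσ)).mp hτσ) ((hmemv hσ).mp hvσ), ?_⟩
      rw [map_sup_ray]

/-- **Iterated star subdivisions commute with transport** (through vectors of `U`).
[cite: KempfEtAl1973, II §2 Thm. 4*] -/
theorem mapOn_starIter_cones :
    ∀ (l : List V), (∀ v ∈ l, v ∈ U) → ∀ {Δ : Fan 𝕜 V} (hΔ : Δ.ConesSubset U),
      ((Δ.starIter l).mapOn E (hΔ.starIter l) hinj).cones =
        ((Δ.mapOn E hΔ hinj).starIter (l.map E)).cones
  | [], _, _, _ => rfl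
  | v :: l, hl, Δ, hΔ => by
    have h1 := mapOn_starIter_cones l (fun w hw => hl w (List.mem_cons_of_mem v hw))
      (hΔ.starSubdivision v)
    have h2 : ((Δ.starSubdivision v).mapOn E (hΔ.starSubdivision v) hinj) =
        (Δ.mapOn E hΔ hinj).starSubdivision (E v) :=
      eq_of_cones_eq (mapOn_starSubdivision_cones (hl v List.mem_cons_self))
    rw [h2] at h1
    exact h1

/-- **Restriction commutes with transport**: for a cone `σ ⊆ U`, the cones of the image fan
inside `σ.map E` are the images of the cones of `Δ` inside `σ`.
[cite: KempfEtAl1973, II §1 Def. 5] -/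
theorem mapOn_restrict_cones {σ : PointedCone 𝕜 V} (hσ : (σ : Set V) ⊆ U) :
    ((Δ.restrict σ).mapOn E (hΔ.restrict σ) hinj).cones =
      ((Δ.mapOn E hΔ hinj).restrict (σ.map E)).cones := by
  ext ρ
  constructor
  · rintro ⟨τ, ⟨hτ, hτσ⟩, rfl⟩
    exact ⟨map_mem_mapOn hτ, map_mono' E hτσ⟩
  · rintro ⟨⟨τ, hτ, rfl⟩, hle⟩
    exact ⟨τ, ⟨hτ, (map_le_map_iff_of_subset hinj (hΔ hτ) hσ).mp hle⟩, rfl⟩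

/-- The restriction of a fan to a cone `τ` has its cones in the span of `τ` (the subspace on
which the links of [KempfEtAl1973] II §1 are injective). [cite: KempfEtAl1973, II §1 Def. 5] -/
theorem conesSubset_restrict_span (Δ : Fan 𝕜 V) (τ : PointedCone 𝕜 V) :
    (Δ.restrict τ).ConesSubset (Submodule.span 𝕜 (τ : Set V)) :=
  Δ.conesSubset_restrict_of_subset Submodule.subset_span

/-- A star subdivision through a vector OUTSIDE the cone `σ` does not change the cones inside `σ`
(a new cone `γ + 𝕜_{≥0} v ⊆ σ` would force `v ∈ σ`). [cite: Fulton1993Toric, §2.6 p. 47] -/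
theorem restrict_starSubdivision_cones_of_not_mem {σ : PointedCone 𝕜 V} {v : V} (hv : v ∉ σ) :
    ((Δ.starSubdivision v).restrict σ).cones = (Δ.restrict σ).cones := by
  ext ρ
  constructor
  · rintro ⟨hρ, hρσ⟩
    rcases mem_starCones_iff.mp hρ with ⟨hρΔ, -⟩ | ⟨τ, -, -, -, rfl⟩
    · exact ⟨hρΔ, hρσ⟩
    · exact absurd (hρσ (self_mem_sup_ray τ v)) hv
  · rintro ⟨hρ, hρσ⟩
    exact ⟨mem_starCones_of_not_mem hρ fun h => hv (hρσ h), hρσ⟩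

/-- **Link-compatibility survives a linked star subdivision.** Suppose the cones of `Δ` inside a
cone `τ ⊆ U` cover `τ` and are carried by `E` exactly onto the cones of `Δ'` inside `τ' = E τ`
(compatibility of the two subdivisions of the linked cells `τ`, `τ'`, [KempfEtAl1973] II §1
Def. 5). Then after the star subdivisions through `v ∈ τ` on one side and through `E v` on the
other, the cones inside `τ` are again carried exactly onto the cones inside `τ'`
([KempfEtAl1973] II §2 Thm. 4*: subdividing a complex cell by cell is consistent on overlaps).
[cite: KempfEtAl1973, II §2 Thm. 4*] -/
theorem mapOn_restrict_starSubdivision_cones {Δ' : Fan 𝕜 W} {τ : PointedCone 𝕜 V}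
    {τ' : PointedCone 𝕜 W} (hτU : (τ : Set V) ⊆ U) (hττ' : τ.map E = τ')
    (hcov : (τ : Set V) ⊆ (Δ.restrict τ).support)
    (hcompat : ((Δ.restrict τ).mapOn E (Δ.conesSubset_restrict_of_subset hτU) hinj).cones =
      (Δ'.restrict τ').cones)
    {v : V} (hv : v ∈ τ) :
    (((Δ.starSubdivision v).restrict τ).mapOn E
        ((Δ.starSubdivision v).conesSubset_restrict_of_subset hτU) hinj).cones =
      ((Δ'.starSubdivision (E v)).restrict τ').cones := by
  -- the cones of `Δ'` inside `τ'` cover `τ'`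
  have hcov' : (τ' : Set W) ⊆ (Δ'.restrict τ').support := by
    rw [← support_congr hcompat, mapOn_support, ← hττ', PointedCone.coe_map]
    exact Set.image_mono hcov
  have hfan : (Δ.restrict τ).mapOn E (Δ.conesSubset_restrict_of_subset hτU) hinj =
      Δ'.restrict τ' := eq_of_cones_eq hcompat
  rw [restrict_starSubdivision_cones hcov',
    mapOn_cones_congr (hΔ' := (Δ.conesSubset_restrict_of_subset hτU).starSubdivision v)
      (hinj' := hinj) (restrict_starSubdivision_cones hcov),
    mapOn_starSubdivision_cones (hΔ := Δ.conesSubset_restrict_of_subset hτU) (hτU hv), hfan]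

/-- Transport preserves simpliciality of fans. [cite: Fulton1993Toric, §2.1 p. 29] -/
theorem IsSimplicial.mapOn (h : Δ.IsSimplicial) : (Δ.mapOn E hΔ hinj).IsSimplicial := by
  rintro _ ⟨σ, hσ, rfl⟩
  exact isSimplicial_map_of_subset hinj (hΔ hσ) (h hσ)

/-- Transport preserves generation by a set of vectors mapped into the target set.
[cite: Fulton1993Toric, §1.4 p. 20] -/
theorem SubsetGenerated.mapOn {X : Set V} {Y : Set W} (h : Δ.SubsetGenerated X)
    (hXY : ∀ x ∈ X, x ∈ U → E x ∈ Y) : (Δ.mapOn E hΔ hinj).SubsetGenerated Y := by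
  classical
  rintro _ ⟨σ, hσ, rfl⟩
  obtain ⟨T, hTX, hσT⟩ := h hσ
  refine ⟨T.image E, ?_, ?_⟩
  · intro y hy
    obtain ⟨x, hx, rfl⟩ := Finset.mem_image.mp (Finset.mem_coe.mp hy)
    exact hXY x (hTX (Finset.mem_coe.mpr hx))
      (hΔ hσ (hσT ▸ PointedCone.subset_hull (Finset.mem_coe.mpr hx)))
  · show σ.map E = _
    rw [hσT, map_hull_finset]

/-- Transport preserves simpliciality over a set of vectors mapped into the target set.
[cite: Fulton1993Toric, §2.6 p. 48] -/
theorem IsSimplicialOver.mapOn {X : Set V} {Y : Set W} (h : Δ.IsSimplicialOver X)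
    (hXY : ∀ x ∈ X, x ∈ U → E x ∈ Y) : (Δ.mapOn E hΔ hinj).IsSimplicialOver Y := by
  classical
  rintro _ ⟨σ, hσ, rfl⟩
  obtain ⟨S, hSX, hli, hσS⟩ := h hσ
  have hSU : (S : Set V) ⊆ U := fun x hx => hΔ hσ (hσS ▸ PointedCone.subset_hull hx)
  refine ⟨S.image E, ?_, ?_, ?_⟩
  · intro y hy
    obtain ⟨x, hx, rfl⟩ := Finset.mem_image.mp (Finset.mem_coe.mp hy)
    exact hXY x (hSX (Finset.mem_coe.mpr hx)) (hSU (Finset.mem_coe.mpr hx))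
  · rw [Finset.coe_image]
    exact linearIndepOn_image_of_subset hinj hSU hli
  · show σ.map E = _
    rw [hσS, map_hull_finset]

end Fan

end FanMap

/-! ## The `v`-coordinate under transport (coordinate spaces) -/

section Coordinates

variable {𝕜 : Type*} [Field 𝕜] [LinearOrder 𝕜] [IsStrictOrderedRing 𝕜]
variable {κ κ' : Type*}

namespace Fan

variable {Δ : Fan 𝕜 (κ → 𝕜)} {E : (κ → 𝕜) →ₗ[𝕜] (κ' → 𝕜)} {U : Submodule 𝕜 (κ → 𝕜)}
  {hΔ : Δ.ConesSubset U} {hinj : ∀ x ∈ U, E x = 0 → x = 0}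

/-- A star decomposition is transported to a star decomposition of the image point with respect
to the image vector, with the same coefficient. [cite: KempfEtAl1973, II §2 Thm. 9*] -/
theorem IsStarDecomp.mapOn {v x : κ → 𝕜} {c : 𝕜} (hv : v ∈ U) (h : Δ.IsStarDecomp v x c) :
    (Δ.mapOn E hΔ hinj).IsStarDecomp (E v) (E x) c := by
  obtain ⟨σ, hσ, hvσ, τ, hτ, hvτ, hτσ, t, ht, hc, hxe⟩ := h
  refine ⟨σ.map E, map_mem_mapOn hσ, ⟨v, hvσ, rfl⟩, τ.map E, map_mem_mapOn hτ,
    fun h' => hvτ ((map_mem_map_iff_of_subset hinj (hΔ hτ) hv).mp h'), map_mono' E hτσ,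
    E t, ⟨t, ht, rfl⟩, hc, ?_⟩
  rw [hxe, map_add, map_smul]

/-- A star decomposition of the image point with respect to the image vector comes from a star
decomposition with the same coefficient, for `v, x ∈ U`. [cite: KempfEtAl1973, II §2 Thm. 9*] -/
theorem IsStarDecomp.of_mapOn {v x : κ → 𝕜} {c : 𝕜} (hv : v ∈ U) (hx : x ∈ U)
    (h : (Δ.mapOn E hΔ hinj).IsStarDecomp (E v) (E x) c) : Δ.IsStarDecomp v x c := by
  obtain ⟨_, ⟨σ, hσ, rfl⟩, hvσ, _, ⟨τ, hτ, rfl⟩, hvτ, hτσ, _, ⟨t, ht, rfl⟩, hc, hxe⟩ := h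
  refine ⟨σ, hσ, (map_mem_map_iff_of_subset hinj (hΔ hσ) hv).mp hvσ, τ, hτ,
    fun h' => hvτ ⟨v, h', rfl⟩, (map_le_map_iff_of_subset hinj (hΔ hτ) (hΔ hσ)).mp hτσ, t, ht, hc,
    ?_⟩
  have hE : E x = E (t + c • v) := by rw [hxe, map_add, map_smul]; rfl
  exact eq_of_map_eq_of_mem hinj hx (U.add_mem (hΔ hτ ht) (U.smul_mem c hv)) hE

/-- **The `v`-coordinate is invariant under transport**: `starCoord_{E v} (E x) = starCoord_v x`
for `v, x ∈ U` ([KempfEtAl1973] II §2: the functions of Ch. I §2 Lemma 2 are compatible with the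
charts). [cite: KempfEtAl1973, II §2 Thm. 9*] -/
theorem starCoord_mapOn {v x : κ → 𝕜} (hv : v ∈ U) (hx : x ∈ U) :
    (Δ.mapOn E hΔ hinj).starCoord (E v) (E x) = Δ.starCoord v x := by
  by_cases hex : ∃ c, Δ.IsStarDecomp v x c
  · obtain ⟨c, hc⟩ := hex
    rw [starCoord_eq_of_isStarDecomp hc, starCoord_eq_of_isStarDecomp (hc.mapOn hv)]
  · have hex' : ¬ ∃ c, (Δ.mapOn E hΔ hinj).IsStarDecomp (E v) (E x) c := by
      rintro ⟨c, hc⟩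
      exact hex ⟨c, hc.of_mapOn hv hx⟩
    rw [starCoord, dif_neg hex', starCoord, dif_neg hex]

/-- **The `v`-coordinate is link-compatible**: under the hypotheses of
`mapOn_restrict_starSubdivision_cones` (the equation `τ.map E = τ'` itself is not needed), for
`x ∈ τ` and `v ∈ τ`, `v ≠ 0`,
`starCoord_{E v}^{Δ'} (E x) = starCoord_v^{Δ} x` — the functions `M f + starCoord` of the
synchronised Lemma-2 step take the same values at linked points.
[cite: KempfEtAl1973, II §2 Thm. 9*] -/
theorem starCoord_map_eq_of_compat [Fintype κ] [Fintype κ'] {Δ' : Fan 𝕜 (κ' → 𝕜)}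
    {τ : PointedCone 𝕜 (κ → 𝕜)} {τ' : PointedCone 𝕜 (κ' → 𝕜)} (hτU : (τ : Set (κ → 𝕜)) ⊆ U)
    (hcov : (τ : Set (κ → 𝕜)) ⊆ (Δ.restrict τ).support)
    (hcompat : ((Δ.restrict τ).mapOn E (Δ.conesSubset_restrict_of_subset hτU) hinj).cones =
      (Δ'.restrict τ').cones)
    {v x : κ → 𝕜} (hv : v ∈ τ) (hv0 : v ≠ 0) (hx : x ∈ τ) :
    Δ'.starCoord (E v) (E x) = Δ.starCoord v x := by
  have hEv0 : E v ≠ 0 := fun h => hv0 (hinj v (hτU hv) h)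
  have hfan : (Δ.restrict τ).mapOn E (Δ.conesSubset_restrict_of_subset hτU) hinj =
      Δ'.restrict τ' := eq_of_cones_eq hcompat
  have hxs' : E x ∈ (Δ'.restrict τ').support := by
    rw [← hfan, mapOn_support]
    exact ⟨x, hcov hx, rfl⟩
  rw [← starCoord_restrict_eq hv0 (hcov hx), ← starCoord_restrict_eq hEv0 hxs', ← hfan]
  exact starCoord_mapOn (hτU hv) (hτU hx)

end Fan

end Coordinates

/-! ## Lattice data under transport (`ℚ^κ → ℚ^{κ'}`) -/

section Lattice

variable {κ κ' : Type*}
variable {E : (κ → ℚ) →ₗ[ℚ] (κ' → ℚ)} {U : Submodule ℚ (κ → ℚ)}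

/-- Under the two lattice conditions of a link — `E` maps the lattice points of `U` to lattice
points, and every lattice point of `E U` is the image of a lattice point of `U`
([KempfEtAl1973] II §1 Def. 5: the charts induce the SAME integral structure) — a vector `x ∈ U`
is a lattice point iff `E x` is. [cite: KempfEtAl1973, II §1 Def. 5] -/
theorem map_mem_latticeN_iff (hinj : ∀ x ∈ U, E x = 0 → x = 0)
    (hlat : ∀ x ∈ U, x ∈ latticeN κ → E x ∈ latticeN κ')
    (hlat' : ∀ y ∈ latticeN κ', y ∈ U.map E → ∃ x ∈ U, x ∈ latticeN κ ∧ E x = y)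
    {x : κ → ℚ} (hx : x ∈ U) : E x ∈ latticeN κ' ↔ x ∈ latticeN κ := by
  refine ⟨fun h => ?_, hlat x hx⟩
  obtain ⟨x', hx'U, hx'N, hEx'⟩ := hlat' (E x) h (Submodule.mem_map_of_mem hx)
  rwa [← eq_of_map_eq_of_mem hinj hx'U hx hEx']

/-- **Primitive vectors are transported**: for a primitive lattice vector `x ∈ U`, `E x` is
primitive ([Fulton1993Toric] §2.6 p. 48 "the first lattice points along the edges", read in either
chart). [cite: KempfEtAl1973, II §1 Def. 5] -/
theorem isPrimitive_map (hinj : ∀ x ∈ U, E x = 0 → x = 0)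
    (hlat : ∀ x ∈ U, x ∈ latticeN κ → E x ∈ latticeN κ')
    (hlat' : ∀ y ∈ latticeN κ', y ∈ U.map E → ∃ x ∈ U, x ∈ latticeN κ ∧ E x = y)
    {x : κ → ℚ} (hx : x ∈ U) (hp : IsPrimitive x) : IsPrimitive (E x) := by
  refine ⟨hlat x hx hp.1, fun h0 => hp.2.1 (hinj x hx h0), fun c hc hcx => ?_⟩
  have hcx' : E (c • x) ∈ latticeN κ' := by rwa [map_smul]
  exact hp.2.2 c hc ((map_mem_latticeN_iff hinj hlat hlat' (U.smul_mem c hx)).mp hcx')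

/-- **Regular generating sets are transported**: for a regular set of generators `S ⊆ U`
(linearly independent lattice vectors with saturated `ℤ`-span), the image set is regular.
[cite: KempfEtAl1973, II §2 Thm. 11*] -/
theorem isRegularGens_image [DecidableEq (κ' → ℚ)] (hinj : ∀ x ∈ U, E x = 0 → x = 0)
    (hlat : ∀ x ∈ U, x ∈ latticeN κ → E x ∈ latticeN κ')
    (hlat' : ∀ y ∈ latticeN κ', y ∈ U.map E → ∃ x ∈ U, x ∈ latticeN κ ∧ E x = y)
    {S : Finset (κ → ℚ)} (hS : (S : Set (κ → ℚ)) ⊆ U) (h : IsRegularGens S) :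
    IsRegularGens (S.image E) := by
  obtain ⟨hSN, hli, hsat⟩ := h
  refine ⟨fun y hy => ?_, ?_, fun y hyN hyspan => ?_⟩
  · obtain ⟨x, hx, rfl⟩ := Finset.mem_image.mp hy
    exact hlat x (hS (Finset.mem_coe.mpr hx)) (hSN x hx)
  · rw [Finset.coe_image]
    exact linearIndepOn_image_of_subset hinj hS hli
  · rw [Finset.coe_image, Submodule.span_image] at hyspan
    obtain ⟨x, hxspan, rfl⟩ := Submodule.mem_map.mp hyspan
    have hxU : x ∈ U := (Submodule.span_le.mpr hS) hxspan
    have hxN : x ∈ latticeN κ := (map_mem_latticeN_iff hinj hlat hlat' hxU).mp hyN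
    have hxZ : x ∈ Submodule.span ℤ (S : Set (κ → ℚ)) := hsat x hxN hxspan
    -- push the `ℤ`-combination through `E`
    refine Submodule.span_induction (p := fun x _ => E x ∈ Submodule.span ℤ ((S.image E : Finset _) : Set (κ' → ℚ)))
      (fun s hs => ?_) ?_ (fun a b _ _ ha hb => ?_) (fun n a _ ha => ?_) hxZ
    · exact Submodule.subset_span (Finset.mem_coe.mpr (Finset.mem_image_of_mem E (Finset.mem_coe.mp hs)))
    · rw [map_zero]; exact Submodule.zero_mem _
    · rw [map_add]; exact Submodule.add_mem _ ha hb
    · rw [map_zsmul]; exact Submodule.smul_mem _ n ha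

/-- **Primitive simplicial generating sets are transported**: if `S` is the primitive simplicial
generating set of a cone `σ ⊆ U`, then `E '' S` is the one of `σ.map E`.
[cite: KempfEtAl1973, II §2 Thm. 11*] -/
theorem isPrimGens_map [DecidableEq (κ' → ℚ)] (hinj : ∀ x ∈ U, E x = 0 → x = 0)
    (hlat : ∀ x ∈ U, x ∈ latticeN κ → E x ∈ latticeN κ')
    (hlat' : ∀ y ∈ latticeN κ', y ∈ U.map E → ∃ x ∈ U, x ∈ latticeN κ ∧ E x = y)
    {σ : PointedCone ℚ (κ → ℚ)} {S : Finset (κ → ℚ)} (hσ : (σ : Set (κ → ℚ)) ⊆ U)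
    (h : IsPrimGens σ S) : IsPrimGens (σ.map E) (S.image E) := by
  obtain ⟨hprim, hli, hσS⟩ := h
  have hSU : (S : Set (κ → ℚ)) ⊆ U := fun x hx => hσ (hσS ▸ PointedCone.subset_hull hx)
  refine ⟨fun y hy => ?_, ?_, ?_⟩
  · obtain ⟨x, hx, rfl⟩ := Finset.mem_image.mp hy
    exact isPrimitive_map hinj hlat hlat' (hSU (Finset.mem_coe.mpr hx)) (hprim x hx)
  · rw [Finset.coe_image]
    exact linearIndepOn_image_of_subset hinj hSU hli
  · rw [hσS, map_hull_finset]

/-- The parallelotope count of a cone is the same in both charts' generating sets once these are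
known to correspond: `conePMult (σ.map E)` is computed from `E '' S`.
[cite: Fulton1993Toric, §2.6 p. 48] -/
theorem conePMult_map_eq_pmult_image [DecidableEq (κ' → ℚ)] (hinj : ∀ x ∈ U, E x = 0 → x = 0)
    (hlat : ∀ x ∈ U, x ∈ latticeN κ → E x ∈ latticeN κ')
    (hlat' : ∀ y ∈ latticeN κ', y ∈ U.map E → ∃ x ∈ U, x ∈ latticeN κ ∧ E x = y)
    {σ : PointedCone ℚ (κ → ℚ)} {S : Finset (κ → ℚ)} (hσ : (σ : Set (κ → ℚ)) ⊆ U)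
    (h : IsPrimGens σ S) : conePMult (σ.map E) = pmult (S.image E) :=
  conePMult_eq (isPrimGens_map hinj hlat hlat' hσ h)

namespace Fan

variable {Δ : Fan ℚ (κ → ℚ)} {hΔ : Δ.ConesSubset U} {hinj : ∀ x ∈ U, E x = 0 → x = 0}

/-- **Rational fans are transported** (every cone generated by lattice vectors).
[cite: KempfEtAl1973, II §2 Thm. 4*] -/
theorem IsRational.mapOn (hlat : ∀ x ∈ U, x ∈ latticeN κ → E x ∈ latticeN κ')
    (h : Δ.IsRational) : (Δ.mapOn E hΔ hinj).IsRational :=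
  SubsetGenerated.mapOn h fun x hxN hxU => hlat x hxU hxN

/-- **Primitively simplicial fans are transported.** [cite: KempfEtAl1973, II §2 Thm. 11*] -/
theorem IsPrimSimplicial.mapOn (hlat : ∀ x ∈ U, x ∈ latticeN κ → E x ∈ latticeN κ')
    (hlat' : ∀ y ∈ latticeN κ', y ∈ U.map E → ∃ x ∈ U, x ∈ latticeN κ ∧ E x = y)
    (h : Δ.IsPrimSimplicial) : (Δ.mapOn E hΔ hinj).IsPrimSimplicial :=
  IsSimplicialOver.mapOn h fun _ hp hxU => isPrimitive_map hinj hlat hlat' hxU hp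

/-- **Regular fans are transported** ([KempfEtAl1973] II §2 Thm. 11*: non-singularity of the
subdivision is read chart by chart). [cite: KempfEtAl1973, II §2 Thm. 11*] -/
theorem IsRegular.mapOn [DecidableEq (κ' → ℚ)] (hlat : ∀ x ∈ U, x ∈ latticeN κ → E x ∈ latticeN κ')
    (hlat' : ∀ y ∈ latticeN κ', y ∈ U.map E → ∃ x ∈ U, x ∈ latticeN κ ∧ E x = y)
    (h : Δ.IsRegular) : (Δ.mapOn E hΔ hinj).IsRegular := by
  rintro _ ⟨σ, hσ, rfl⟩
  obtain ⟨S, hS, hσS⟩ := h hσ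
  have hSU : (S : Set (κ → ℚ)) ⊆ U := fun x hx => hΔ hσ (hσS ▸ PointedCone.subset_hull hx)
  refine ⟨S.image E, isRegularGens_image hinj hlat hlat' hSU hS, ?_⟩
  show σ.map E = _
  rw [hσS, map_hull_finset]

end Fan

end Lattice

end Literature.Geometry.PolyhedralFans

end
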